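import Summits.PneNP.PneNP.Theses.RootDecompEfProver
import Summits.PneNP.PneNP.Theses.FeasibleWitnessing
import Summits.PneNP.PneNP.Theorems.EfNotPOptimalEFProofSearchOfCollapse
import Literature.Computability.MetaComplexity.Frege
import Literature.Computability.MetaComplexity.FregeProofs
import Literature.Computability.Complexity.ProofComplexityNP
import Literature.Computability.Complexity.StringCopy
import Literature.Computability.Complexity.ReductionsProofs
import Literature.Computability.Complexity.BrickAlgebra
import Literature.Computability.Complexity.TM2Iterate
import Literature.Computability.Complexity.NondeterministicProofs
import Literature.Computability.Complexity.SearchToDecision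
import Literature.Computability.Complexity.CookBridges

/-!
# `FeasibleWitnessing.EFLowerBound → RootDecompEfProver.NoFPProverEF` — the EF renaming lemma and the
cross-route edge stmt-PneNP-10743 ⟹ stmt-PneNP-23777

Support file (S-free; closes no item, defines no proposition) for crux `RootDecompEfProver.NoFPProverEF`
(stmt-PneNP-23777) of route `route-PneNP-RootDecompEfProver` (decomp-pnenp cell, node N1). Port of the
lens-5 g12 LANDING-READY file (extracted from the node `EfCurrencySeam.lean`, Parts A–B; critic
NODE-VERDICT 2026-08-30T11:32:13Z CLEARED, landing pair ENDORSED), made DEFINITION-FREE: the lens's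
`HasShortEFCerts F` is written out, and its `EFLB` is the tree declaration
`FeasibleWitnessing.EFLowerBound` (stmt-PneNP-10743) verbatim. Content:

* the Cook–Reckhow RENAMING LEMMA for extended Frege — EF-proofs are closed under injective renamings of
  atoms (`isEFProofOf_map_rename`), hence a BIT bound on EF-certificates (for the tree's checker
  `EFProofSearch.chkFn F`, against `|encode φ|`) gives the SYMBOL bound `F.IsEFPolyBounded`
  (`isEFPolyBounded_of_encodingBounded`, `isEFPolyBounded_of_shortCerts`, `isEFPolyBounded_iff_shortCerts`);
* the EDGE `noFPProverEF_of_item10743 : FeasibleWitnessing.EFLowerBound → RootDecompEfProver.NoFPProverEF`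
  (10743 ⟹ 23777: an EF lower bound in the ledger's size currency forbids polynomial-time EF-provers);
* law-D EXACTNESS of both routes' cuts, hypothesis-free: `collapseReachesEF_iff_imp : 17354 ↔ (23777 → S)`
  and `feasibleWitnessing_exact : 17354 ↔ (10743 → S)`.

[cite: CookReckhow1979, §1 (remark after Def. 1.5), §4] [cite: Krajicek1995, Def. 4.1.3 remark, §4.4]
Standard axioms only.
-/

namespace Summit.PneNP.PneNP.Theorems.RootDecompEfProverNoFPProverEFOfEFLowerBound

open _root_.Computability
open Literature.Computability.Complexity Literature.Computability.MetaComplexity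
open Literature.Computability.Complexity.PropForm (IsTautology)
open Summit.PneNP.PneNP.Theorems.EFProofSearch
open Summit.PneNP.PneNP.Theses (RootDecompEfProver.NoFPProverEF RootDecompEfProver.CollapseReachesEF
  RootDecompEfProver.closes FeasibleWitnessing.EFLowerBound FeasibleWitnessing.CollapseReachesEF)
open Literature.PNP
open Polynomial (X C)

/-! ## Part A.  The renaming lemma for extended Frege (bits ⟹ size) -/

section Renaming

variable {F : FregeSystem}

/-- **EF-proofs are closed under injective renaming of atoms.**  (Frege lines: `IsInferred.map_subst`;
an extension axiom `p ↔ ψ` goes to `g p ↔ ψ[g]`, and `g p` stays fresh because `g` is injective.)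
[cite: CookReckhow1979, §4] -/
theorem isEFProofOf_map_rename {π : List (PropForm ℕ)} {φ : PropForm ℕ} (h : F.IsEFProofOf π φ)
    {g : ℕ → ℕ} (hg : Function.Injective g) :
    F.IsEFProofOf (π.map (PropForm.subst fun x => PropForm.var (g x)))
      (φ.subst fun x => PropForm.var (g x)) := by
  refine ⟨fun k hk => ?_, by rw [List.getLast?_map, h.2]; rfl⟩
  rw [List.length_map] at hk
  rw [List.getElem_map, ← List.map_take]
  rcases h.1 k hk with hinf | ⟨p, ψ, hθ, hpψ, hpφ, hpπ⟩
  · exact Or.inl (hinf.map_subst _)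
  · refine Or.inr ⟨g p, ψ.subst fun x => PropForm.var (g x), by rw [hθ]; rfl, ?_, ?_, ?_⟩
    · rw [PropForm.vars_subst_var, hg.mem_finset_image]; exact hpψ
    · rw [PropForm.vars_subst_var, hg.mem_finset_image]; exact hpφ
    · intro χ hχ
      obtain ⟨χ₀, hχ₀, rfl⟩ := List.mem_map.1 hχ
      rw [PropForm.vars_subst_var, hg.mem_finset_image]
      exact hpπ χ₀ hχ₀

/-- Length of the encoding of a formula all of whose variables are `≤ m`:
`|encode φ| ≤ 2·size + 2 + (6 + 2m)·size`. -/
theorem length_encode_le_of_vars_le {m : ℕ} (φ : PropForm ℕ) (h : ∀ x ∈ φ.vars, x ≤ m) :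
    (encodingPropForm.encode φ).length ≤ 2 * φ.size + 2 + (6 + 2 * m) * φ.size := by
  rw [Literature.Computability.MetaComplexity.length_encode_propForm]
  exact Nat.add_le_add_left (φ.length_code_le h) _

/-- **RENAMING LEMMA (bits ⟹ size).**  If every tautology `φ` has an EF-proof over `F` of `proofSize` at
most `p (|encode φ|)` (the BIT length of `φ`, in which the atom `var i` costs `O(log i)`), then `F` is
EF-polynomially-bounded in the ledger's sense (`proofSize ≤ p' (φ.size)`).  Proof: rename the `≤ φ.size`
atoms of `φ` into `{0,…,n-1}` (`exists_renaming`), so that `|encode φ₁| ≤ (2k+10)·k`, take the short proof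
of the renamed tautology `φ₁`, and rename it back by the globally injective map
`G y := if y ∈ g '' vars φ then g⁻¹ y else B + 1 + y` (`B` above all atoms of `φ`), which is the identity
renaming on `φ` and keeps extension atoms fresh (`isEFProofOf_map_rename`); `proofSize` is unchanged.
[cite: CookReckhow1979, §1 remark after Def. 1.5 and §4] [cite: Krajicek1995, Def. 4.5.2 and §4.4] -/
theorem isEFPolyBounded_of_encodingBounded (p : Polynomial ℕ)
    (h : ∀ φ : PropForm ℕ, φ.IsTautology →
      ∃ π, F.IsEFProofOf π φ ∧ proofSize π ≤ p.eval (encodingPropForm.encode φ).length) :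
    F.IsEFPolyBounded := by
  classical
  refine ⟨p.comp (C 2 * X + C 2 + (C 6 + C 2 * X) * X), fun φ hφ => ?_⟩
  obtain ⟨g, g', hg, hg'⟩ := FregeSystem.exists_renaming φ.vars
  -- the renamed tautology and its short proof
  set φ₁ : PropForm ℕ := φ.subst fun x => PropForm.var (g x) with hφ₁
  have hφ₁t : φ₁.IsTautology := hφ.subst _
  obtain ⟨π₁, hπ₁, hsz⟩ := h φ₁ hφ₁t
  -- the back-renaming, injective on all of ℕ
  set B : ℕ := φ.vars.sup id with hB
  have hBle : ∀ x ∈ φ.vars, x ≤ B := fun x hx => Finset.le_sup (f := id) hx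
  set G : ℕ → ℕ := fun y => if y ∈ φ.vars.image g then g' y else B + 1 + y with hG
  have hGg : ∀ x ∈ φ.vars, G (g x) = x := by
    intro x hx
    have hmem : g x ∈ φ.vars.image g := Finset.mem_image_of_mem g hx
    simp only [hG, hmem, if_true, hg' x hx]
  have hG'mem : ∀ y ∈ φ.vars.image g, g' y ∈ φ.vars ∧ g (g' y) = y := by
    intro y hy
    obtain ⟨x, hx, rfl⟩ := Finset.mem_image.1 hy
    rw [hg' x hx]
    exact ⟨hx, rfl⟩
  have hGinj : Function.Injective G := by
    intro y₁ y₂ hy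
    by_cases h₁ : y₁ ∈ φ.vars.image g <;> by_cases h₂ : y₂ ∈ φ.vars.image g
    · simp only [hG, h₁, h₂, if_true] at hy
      rw [← (hG'mem y₁ h₁).2, ← (hG'mem y₂ h₂).2, hy]
    · simp only [hG, h₁, h₂, if_true, if_false] at hy
      have := hBle _ (hG'mem y₁ h₁).1
      omega
    · simp only [hG, h₁, h₂, if_true, if_false] at hy
      have := hBle _ (hG'mem y₂ h₂).1
      omega
    · simp only [hG, h₁, h₂, if_false] at hy
      omega
  -- rename the short proof back
  have hπ := isEFProofOf_map_rename hπ₁ hGinj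
  rw [hφ₁, PropForm.subst_var_subst_var hGg] at hπ
  refine ⟨_, hπ, ?_⟩
  rw [FregeSystem.proofSize_map_subst_var]
  -- size bookkeeping: |encode φ₁| ≤ 2k + 2 + (6 + 2k) k, k = φ.size
  have hk : φ₁.size = φ.size := PropForm.size_subst_var g φ
  have hcard : φ.vars.card ≤ φ.size := φ.card_vars_le_size
  have hvars₁ : ∀ x ∈ φ₁.vars, x ≤ φ.size := by
    intro x hx
    rw [hφ₁, PropForm.vars_subst_var, Finset.mem_image] at hx
    obtain ⟨y, hy, rfl⟩ := hx
    exact ((hg y hy).trans_le hcard).le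
  have henc : (encodingPropForm.encode φ₁).length ≤
      (C 2 * X + C 2 + (C 6 + C 2 * X) * X : Polynomial ℕ).eval φ.size := by
    refine (length_encode_le_of_vars_le φ₁ hvars₁).trans ?_
    rw [hk]
    simp only [Polynomial.eval_add, Polynomial.eval_mul, Polynomial.eval_C, Polynomial.eval_X]
    exact le_rfl
  calc proofSize π₁ ≤ p.eval (encodingPropForm.encode φ₁).length := hsz
    _ ≤ p.eval ((C 2 * X + C 2 + (C 6 + C 2 * X) * X : Polynomial ℕ).eval φ.size) :=
        TM2Iter.eval_mono p henc
    _ = (p.comp (C 2 * X + C 2 + (C 6 + C 2 * X) * X)).eval φ.size := by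
        rw [Polynomial.eval_comp]

/-- The size-currency statement trivially gives the bit-currency one (`φ.size ≤ |encode φ|`). -/
theorem encodingBounded_of_isEFPolyBounded (h : F.IsEFPolyBounded) :
    ∃ p : Polynomial ℕ, ∀ φ : PropForm ℕ, φ.IsTautology →
      ∃ π, F.IsEFProofOf π φ ∧ proofSize π ≤ p.eval (encodingPropForm.encode φ).length := by
  obtain ⟨p, hp⟩ := h
  refine ⟨p, fun φ hφ => ?_⟩
  obtain ⟨π, hπ, hsz⟩ := hp φ hφ
  exact ⟨π, hπ, hsz.trans (TM2Iter.eval_mono p (size_le_length_encode φ))⟩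

/-- The proof decoded from an accepted certificate has `proofSize` polynomial in the certificate pair
(`sound_chkFn`: `fullFn` outputs its code; `fullFn ∈ FP`; `proofSize ≤ |code|`). -/
theorem exists_poly_proofSize_extractProof (F : FregeSystem) :
    ∃ r : Polynomial ℕ, ∀ (φ : PropForm ℕ) (y : List Bool),
      chkFn F (boolPair (encodingPropForm.encode φ) y) = [true] →
        proofSize (extractProof (encodingPropForm.encode φ) y) ≤
          r.eval ((encodingPropForm.encode φ).length + y.length) := by
  obtain ⟨s, hs⟩ := exists_poly_length_le_of_mem_FP fullFn_mem_FP
  refine ⟨s.comp (C 2 * X + C 2), fun φ y hy => ?_⟩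
  have h := (sound_chkFn hy).2
  calc proofSize (extractProof (encodingPropForm.encode φ) y)
      ≤ (encodingPropForm.listBool.encode (extractProof (encodingPropForm.encode φ) y)).length :=
        Literature.Computability.MetaComplexity.proofSize_le_length_encode _
    _ = (fullFn (boolPair (encodingPropForm.encode φ) y)).length := by rw [h]
    _ ≤ s.eval (boolPair (encodingPropForm.encode φ) y).length := hs _
    _ ≤ s.eval ((C 2 * X + C 2 : Polynomial ℕ).eval
          ((encodingPropForm.encode φ).length + y.length)) := by
        refine TM2Iter.eval_mono s ?_
        simp only [length_boolPair, Polynomial.eval_add, Polynomial.eval_mul, Polynomial.eval_C,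
          Polynomial.eval_X]
        omega
    _ = (s.comp (C 2 * X + C 2)).eval ((encodingPropForm.encode φ).length + y.length) := by
        rw [Polynomial.eval_comp]

/-- **Bits ⟹ size, certificate form**: SHORT CERTIFICATES (bit currency, the A-side notion of N1 and of
the Q-dial and V-dial: every tautology has a `chkFn F`-accepted certificate of length polynomial in
`|encode φ|`) make `F` EF-polynomially-bounded in the ledger's (symbol-size) sense. -/
theorem isEFPolyBounded_of_shortCerts
    (h : ∃ q : Polynomial ℕ, ∀ φ : PropForm ℕ, φ.IsTautology →
      ∃ c : List Bool, c.length ≤ q.eval (encodingPropForm.encode φ).length ∧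
        chkFn F (boolPair (encodingPropForm.encode φ) c) = [true]) :
    F.IsEFPolyBounded := by
  obtain ⟨q, hq⟩ := h
  obtain ⟨r, hr⟩ := exists_poly_proofSize_extractProof F
  refine isEFPolyBounded_of_encodingBounded (r.comp (X + q)) fun φ hφ => ?_
  obtain ⟨c, hlen, hc⟩ := hq φ hφ
  refine ⟨_, (sound_chkFn hc).1, (hr φ c hc).trans ?_⟩
  rw [Polynomial.eval_comp, Polynomial.eval_add, Polynomial.eval_X]
  exact TM2Iter.eval_mono r (by omega)

/-- Size ⟹ bits, certificate form (tree: `EFProofSearch.complete_chkFn`). -/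
theorem shortCerts_of_isEFPolyBounded (h : F.IsEFPolyBounded) :
    ∃ q : Polynomial ℕ, ∀ φ : PropForm ℕ, φ.IsTautology →
      ∃ c : List Bool, c.length ≤ q.eval (encodingPropForm.encode φ).length ∧
        chkFn F (boolPair (encodingPropForm.encode φ) c) = [true] := by
  obtain ⟨q, hq⟩ := complete_chkFn h
  exact ⟨q, fun φ hφ => hq φ hφ⟩

/-- **THE SEAM, closed**: the ledger's notion (stmt-PneNP-17354's `IsEFPolyBounded`) and the
short-certificate notion of piece A / the dials coincide, for EVERY rule list `F` (no soundness or
completeness needed). -/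
theorem isEFPolyBounded_iff_shortCerts :
    F.IsEFPolyBounded ↔
      ∃ q : Polynomial ℕ, ∀ φ : PropForm ℕ, φ.IsTautology →
        ∃ c : List Bool, c.length ≤ q.eval (encodingPropForm.encode φ).length ∧
          chkFn F (boolPair (encodingPropForm.encode φ) c) = [true] :=
  ⟨shortCerts_of_isEFPolyBounded, isEFPolyBounded_of_shortCerts⟩

/-- A polynomial-time EF-PROVER (the object piece A forbids) yields short certificates. -/
theorem hasShortEFCerts_of_prover {g : List Bool → List Bool} (hg : g ∈ FP)
    (hall : ∀ φ : PropForm ℕ, φ.IsTautology →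
      chkFn F (boolPair (encodingPropForm.encode φ) (g (encodingPropForm.encode φ))) = [true]) :
    ∃ q : Polynomial ℕ, ∀ φ : PropForm ℕ, φ.IsTautology →
      ∃ c : List Bool, c.length ≤ q.eval (encodingPropForm.encode φ).length ∧
        chkFn F (boolPair (encodingPropForm.encode φ) c) = [true] := by
  obtain ⟨s, hs⟩ := exists_poly_length_le_of_mem_FP hg
  exact ⟨s, fun φ hφ => ⟨_, hs _, hall φ hφ⟩⟩

end Renaming

/-! ## Part B.  The edge 10743 ⟹ 23777 and law-D exactness -/

section Exactness

/-- Under the collapse a Frege system with p-bounded EF has a polynomial-time EF-prover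
(search-to-decision on the certificate language; the mechanism of N1's `closes`). -/
theorem exists_prover_of_collapse (hS : ¬ PneNP) {F : FregeSystem} (hb : F.IsEFPolyBounded) :
    ∃ g ∈ FP, ∀ φ : PropForm ℕ, φ.IsTautology →
      chkFn F (boolPair (encodingPropForm.encode φ) (g (encodingPropForm.encode φ))) = [true] := by
  -- `P = NP` in the tree's classes, from `¬ S` (as in N1's `closes`)
  have hNP : Nondeterministic.NP ⊆ Classes.P := fun A hA => by
    by_contra hA'
    exact hS ⟨A, by rw [CookBridges.np_bool_eq]; exact hA, by rw [p_bool_eq]; exact hA'⟩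
  obtain ⟨q, hq⟩ := complete_chkFn hb
  obtain ⟨g, hg, hspec⟩ := exists_searchFn_of_NP_subset_P hNP (chkLang_mem_P F) q
  exact ⟨g, hg, fun φ hφ => (hspec _ (hq φ hφ)).2⟩

/-- **THE EDGE 10743 ⟹ 23777.** The size-currency EF lower bound `FeasibleWitnessing.EFLowerBound`
(stmt-PneNP-10743: no Frege system has p-bounded EF) implies piece A `RootDecompEfProver.NoFPProverEF`
(stmt-PneNP-23777) — an implication between the ledger's own notions, no currency caveat. -/
theorem noFPProverEF_of_item10743 (h : FeasibleWitnessing.EFLowerBound) :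
    RootDecompEfProver.NoFPProverEF := by
  rintro F hF ⟨g, hg, hall⟩
  exact h F hF (isEFPolyBounded_of_shortCerts (hasShortEFCerts_of_prover hg hall))

/-- Piece A and the collapse give the size-currency lower bound (stmt-PneNP-10743). -/
theorem efLowerBound_of_noFPProverEF_of_collapse (hA : RootDecompEfProver.NoFPProverEF)
    (hS : ¬ PneNP) : FeasibleWitnessing.EFLowerBound :=
  fun F hF hb => hA F hF (exists_prover_of_collapse hS hb)

/-- **LAW-D EXACTNESS of N1's cut, in kernel**: piece B (stmt-PneNP-17354) is EXACTLY the residual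
`A → S` of piece A (stmt-PneNP-23777).  (`→` is N1's `closes`; `←`: were no Frege system EF-p-bounded,
a polynomial-time EF-prover would give short certificates hence p-bounded EF, so A holds and `A → S`
contradicts `¬ S`.)  Hypothesis-free. -/
theorem collapseReachesEF_iff_imp :
    RootDecompEfProver.CollapseReachesEF ↔ (RootDecompEfProver.NoFPProverEF → PneNP) := by
  constructor
  · exact fun hB hA => RootDecompEfProver.closes hA hB
  · intro h hS
    by_contra hne
    push Not at hne
    exact hS (h (noFPProverEF_of_item10743 fun F hF => hne F hF))

/-- law-D exactness of route FeasibleWitnessing's cut (and of N1's, the two pieces B being the same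
declaration by name): stmt-PneNP-17354 ↔ (stmt-PneNP-10743 → S). Hypothesis-free. -/
theorem feasibleWitnessing_exact :
    FeasibleWitnessing.CollapseReachesEF ↔ (FeasibleWitnessing.EFLowerBound → PneNP) := by
  constructor
  · intro hB hLB
    by_contra hS
    obtain ⟨F, hF, hb⟩ := hB hS
    exact hLB F hF hb
  · intro h hS
    by_contra hne
    push Not at hne
    exact hS (h fun F hF => hne F hF)

/-- The same exactness read on N1's residual by name: `RootDecompEfProver.CollapseReachesEF`
(stmt-PneNP-17354, shared with route FeasibleWitnessing) ↔ (stmt-PneNP-10743 → S). -/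
theorem collapseReachesEF_iff_efLowerBound_imp :
    RootDecompEfProver.CollapseReachesEF ↔ (FeasibleWitnessing.EFLowerBound → PneNP) :=
  feasibleWitnessing_exact

end Exactness

end Summit.PneNP.PneNP.Theorems.RootDecompEfProverNoFPProverEFOfEFLowerBound
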